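import Literature.MathematicalPhysics.QuantumFieldTheory.Balaban1983to89.B9Eq346MixedLegAtPinsL2

/-!
# `Balaban1983to89.B9Eq346MixedLegAtPinsL2Closed` — [B9] Cor 3.6 ∕ (3.46) ∕ (3.87)–(3.90): the rows-18 mixed `L²` leg `L2MixedLegs37` at the N06 certificate's pins,
# dag-n06-w7's member-uniform theorem `B9Eq346MixedLegAtPinsL2.blockBd_mixedLeg_memberY` WITH ITS FOUR EXISTENTIAL CONSTANTS NAMED (`MMix aMix BMix δMix`) — the closed
# terms the certificate's displayed numerics (`p.M₁`, `p.a₁`, `pM.BM`, `p.δ₀`) are compared with — and both the `lm`-body and the schema `L2MixedLegs37` restated AT THEM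

T. Bałaban, *Propagators for lattice gauge theories in a background field*, Commun. Math. Phys. **99** (1985) 389–434 [`Balaban1985BackgroundPropagators`, "B9"],
Cor 3.6 p. 408, Thm 3.1 (3.46) p. 398, (3.87)–(3.90) pp. 409–410, (3.35) p. 396; T. Bałaban, *Propagators and renormalization transformations for lattice gauge
theories. II*, Commun. Math. Phys. **96** (1984) 223–250 [`Balaban1984PropagatorsII`], (2.46) p. 231, (2.51)–(2.54) pp. 232–233, p. 235.

statement-level skeleton of published theorems with citation tags; proofs where landed; nothing here is a claim about the Yang–Mills mass gap

WHY THIS FILE (cell `pub-ymgap`, Track A node N06 [B9]; width seat `pub-ymgap-dag-n06-w7` (g0) on the knit owner dag-n06-d's word «rows-18 legs at the pins with NAMED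
constants», pub-ymgap bus 2026-08-28; the drill of `B9Eq346GradGpDivAtPinsL2Closed`).  `blockBd_mixedLeg_memberY` (p617225) proves the `L2MixedLegs37.lm` body at the pins in the
shape `∃ M_M a_M B_M δ_M > 0, ∀ hG x, M_M ≤ M_x → ∀ α₀ > 0, c₀·M_x·α₀ ≤ a_M → ∀ U, Reg335 c₀ α₀ U → ∀ bI hlev hβ1 R₀ H₀ 𝔬 𝔡 c ic ν μ (pins), BlockBd 𝔬.blk 𝔬.blk (leg) (1_{S_c}·B_M·e^{−δ_M d})`.
The certificate merges thresholds (`max ∕ min`) and compares rates and constants ACROSS displayed letters, so the four constants must be TERMS: this file names them by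
`Classical.choose` — `MMix aMix BMix δMix` (functions of `d ℓ hd hL b₀ b₁ M⋆ N c₀` and the proof `hc₀ : 0 < c₀`) — and restates AT THEM the body (`blockBd_mixedLeg_memberY_at`,
any index type) and the schema (`l2MixedLegs37_memberY_at`: `L2MixedLegs37 𝔬 𝔡 R₀ H₀ (SblkY x bI) BMix δMix U` at `ι := cubes`, decided by the certificate's own
`DecidableEq (geo9Y x).Site`), with the four positivity facts.  Nothing is re-proved; nothing of [B9] is asserted beyond p617225.

HONEST SCOPE.  Four named constants and two specialisations; COUNT-NEUTRAL; N06 NOT discharged; K1⁷ NOT closed; one finite lattice programme — nothing continuum, nothing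
about OS positivity or the mass gap.
-/

noncomputable section

namespace Literature.MathematicalPhysics.QuantumFieldTheory.Balaban1983to89.B9Eq346MixedLegAtPinsL2Closed

open Literature.MathematicalPhysics.QuantumFieldTheory.Balaban1983to89
open Node00 B6KLevelCensusIndexV1 B6Geom246MultiLevelBox B6MultiLevelTorusOperator B6GlobalChartV1 B9BackgroundsKLevelV1 B6Geom246MultiLevelTorus
open Literature.MathematicalPhysics.QuantumFieldTheory.Balaban1983to89.B6Ineq2142KLevelV1 (lvl β)
open Literature.MathematicalPhysics.QuantumFieldTheory.Balaban1983to89.B9Ineq349SiteComposite (cdSL cdsSL)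
open Literature.MathematicalPhysics.QuantumFieldTheory.Balaban1983to89.B9CoReadingCoords (coordOpK)
open Literature.MathematicalPhysics.QuantumFieldTheory.Balaban1983to89.B9CoReadingCoordsS (XSK blkSK sIK)
open Literature.MathematicalPhysics.QuantumFieldTheory.Balaban1983to89.B9CoReadingCoordsTranspose (TrIdx trBasis)
open Literature.MathematicalPhysics.QuantumFieldTheory.Balaban1983to89.B9Thm34Ext (toB6)
open Literature.MathematicalPhysics.QuantumFieldTheory.Balaban1983to89.B9SectDL2Decay (BlockBd)
open Literature.MathematicalPhysics.QuantumFieldTheory.Balaban1983to89.B9PinMembersKLevelV1 (MemberY geo9Y bg9Y)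
open Literature.MathematicalPhysics.QuantumFieldTheory.Balaban1983to89.B9Thm37Sum (mulOp)
open Literature.MathematicalPhysics.QuantumFieldTheory.Balaban1983to89.B9Thm37Whole (Ops)
open Literature.MathematicalPhysics.QuantumFieldTheory.Balaban1983to89.B9RWSums346SecondDiffGp (DirOps37)
open Literature.MathematicalPhysics.QuantumFieldTheory.Balaban1983to89.B9RWSums346MixedPair (L2MixedLegs37)
open Literature.MathematicalPhysics.QuantumFieldTheory.Balaban1983to89.B6Cover236MultiLevelBlocks (cubes)
open Literature.MathematicalPhysics.QuantumFieldTheory.Balaban1983to89.B9WalkLettersCoordsS (SblkY hWalkY gsqcoS)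
open Literature.MathematicalPhysics.QuantumFieldTheory.Balaban1983to89.B9Eq346MixedLegAtPinsL2 (blockBd_mixedLeg_memberY)
open scoped Matrix Matrix.Norms.L2Operator

variable (d ℓ : ℕ) (hd : 1 ≤ d + 1) (hL : Odd (ℓ + 1) ∧ 1 < ℓ + 1) (b₀ b₁ : ℝ) (Mstar N : ℕ) [NeZero N] (c₀ : ℝ) (hc₀ : 0 < c₀)

/-- **THE THRESHOLD `M_M` OF THE ROWS-18 MIXED `L²` LEG, NAMED**: the first existential constant of dag-n06-w7's `blockBd_mixedLeg_memberY` (a function of the member family's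
data `d ℓ b₀ b₁ M⋆ N` and the class constant `c₀`). [cite: Balaban1985BackgroundPropagators, Cor 3.6 p.408, (3.46) p.398] -/
def MMix : ℝ := (blockBd_mixedLeg_memberY d ℓ hd hL b₀ b₁ Mstar N hc₀).choose

/-- **THE SMALLNESS THRESHOLD `a_M` (`c₀·M·α₀ ≤ a_M`) OF THE ROWS-18 MIXED `L²` LEG, NAMED** (second existential constant of `blockBd_mixedLeg_memberY`).
[cite: Balaban1985BackgroundPropagators, Cor 3.6 p.408, (3.35) p.396] -/
def aMix : ℝ := (blockBd_mixedLeg_memberY d ℓ hd hL b₀ b₁ Mstar N hc₀).choose_spec.choose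

/-- **THE CONSTANT `B_M` OF THE ROWS-18 MIXED `L²` LEG, NAMED** (third existential constant of `blockBd_mixedLeg_memberY`; print's `O(1)` of (3.46) at `G′_□`, Cor 3.6
«independent of □»). [cite: Balaban1985BackgroundPropagators, Cor 3.6 p.408, (3.46) p.398] -/
def BMix : ℝ := (blockBd_mixedLeg_memberY d ℓ hd hL b₀ b₁ Mstar N hc₀).choose_spec.choose_spec.choose

/-- **THE DECAY RATE `δ_M` OF THE ROWS-18 MIXED `L²` LEG, NAMED** (fourth existential constant of `blockBd_mixedLeg_memberY`) — the closed term the certificate's rate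
comparison `p.δ₀ ≤ δ_M` refers to. [cite: Balaban1985BackgroundPropagators, Cor 3.6 p.408, (3.46) p.398] -/
def δMix : ℝ := (blockBd_mixedLeg_memberY d ℓ hd hL b₀ b₁ Mstar N hc₀).choose_spec.choose_spec.choose_spec.choose

/-- The defining property of the four named constants (dag-n06-w7's theorem, unpacked once). [cite: Balaban1985BackgroundPropagators, Cor 3.6 p.408, (3.46) p.398, bookkeeping] -/
private theorem specMix : 0 < MMix d ℓ hd hL b₀ b₁ Mstar N c₀ hc₀ ∧ 0 < aMix d ℓ hd hL b₀ b₁ Mstar N c₀ hc₀ ∧ 0 < BMix d ℓ hd hL b₀ b₁ Mstar N c₀ hc₀ ∧ 0 < δMix d ℓ hd hL b₀ b₁ Mstar N c₀ hc₀ ∧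
    ∀ {G : Subgroup (Matrix (Fin N) (Fin N) ℂ)ˣ} (_ : G ≤ B7Prop2Explicit.unitaryUnits (Matrix (Fin N) (Fin N) ℂ))
      (x : MemberY d ℓ hd hL b₀ b₁ Mstar), MMix d ℓ hd hL b₀ b₁ Mstar N c₀ hc₀ ≤ (geo9Y x).M → ∀ α₀ : ℝ, 0 < α₀ → c₀ * (geo9Y x).M * α₀ ≤ aMix d ℓ hd hL b₀ b₁ Mstar N c₀ hc₀ →
      ∀ (U : (bg9Y (Matrix (Fin N) (Fin N) ℂ) G x).Cfg), (bg9Y (Matrix (Fin N) (Fin N) ℂ) G x).Reg335 c₀ α₀ U →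
      ∀ {bI : FBondY x.toKIdx → IBondY x.toKIdx} (_ : ∀ f, lvl x.hN x.D x.hk (bI f) = (blkV1 x.hN x.D f).1.1)
        (_ : ∀ f, (geomT x.D).dist (β x.hN x.D x.hk (bI f)) (blkV1 x.hN x.D f) ≤ 1) (R₀ : ℝ) (H₀ : Prop) [Fintype (geo9Y x).Site]
        {Y ι : Type} (𝔬 : Ops (geo9Y x) (bg9Y (Matrix (Fin N) (Fin N) ℂ) G x) (XSK (TrIdx N) x.toKIdx) Y ι) (𝔡 : DirOps37 𝔬 (Fin (d + 1)))
        (c : ↥(cubes x.toKIdx.D.toDomains)) (ic : ι) (ν μ : Fin (d + 1))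
        (_ : 𝔬.blk = blkSK x.toKIdx (sIK x.toKIdx bI)) (_ : 𝔬.h ic = hWalkY x c)
        (_ : 𝔬.Gsq U ic = gsqcoS x (trBasis N) (bg9Y (Matrix (Fin N) (Fin N) ℂ) G x) (fun U => U) (parSymY x.toKIdx) c U)
        (_ : 𝔡.Dd U ν = (etaS x.toKIdx)⁻¹ • coordOpK (trBasis N) (fun _ : Fin (d + 1) => (cdSL x.toKIdx U ν).restrictScalars ℝ))
        (_ : 𝔡.Dsd U μ = (etaS x.toKIdx)⁻¹ • coordOpK (trBasis N) (fun _ : Fin (d + 1) => (cdsSL x.toKIdx U μ).restrictScalars ℝ)),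
        BlockBd (g := toB6 (geo9Y x) R₀ H₀) 𝔬.blk 𝔬.blk (𝔡.Dd U ν ∘ₗ ((mulOp (𝔬.h ic) * 𝔬.Gsq U ic * mulOp (𝔬.h ic)) ∘ₗ 𝔡.Dsd U μ))
          (fun a a' => (if a ∈ SblkY x bI c then (1 : ℝ) else 0) * (BMix d ℓ hd hL b₀ b₁ Mstar N c₀ hc₀ * Real.exp (-(δMix d ℓ hd hL b₀ b₁ Mstar N c₀ hc₀ * (geo9Y x).dist a a')))) :=
  (blockBd_mixedLeg_memberY d ℓ hd hL b₀ b₁ Mstar N hc₀).choose_spec.choose_spec.choose_spec.choose_spec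

/-- `0 < MMix`. [cite: Balaban1985BackgroundPropagators, Cor 3.6 p.408, bookkeeping] -/
theorem MMix_pos : 0 < MMix d ℓ hd hL b₀ b₁ Mstar N c₀ hc₀ := (specMix d ℓ hd hL b₀ b₁ Mstar N c₀ hc₀).1

/-- `0 < aMix`. [cite: Balaban1985BackgroundPropagators, Cor 3.6 p.408, bookkeeping] -/
theorem aMix_pos : 0 < aMix d ℓ hd hL b₀ b₁ Mstar N c₀ hc₀ := (specMix d ℓ hd hL b₀ b₁ Mstar N c₀ hc₀).2.1

/-- `0 < BMix`. [cite: Balaban1985BackgroundPropagators, Cor 3.6 p.408, bookkeeping] -/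
theorem BMix_pos : 0 < BMix d ℓ hd hL b₀ b₁ Mstar N c₀ hc₀ := (specMix d ℓ hd hL b₀ b₁ Mstar N c₀ hc₀).2.2.1

/-- `0 < δMix`. [cite: Balaban1985BackgroundPropagators, Cor 3.6 p.408, bookkeeping] -/
theorem δMix_pos : 0 < δMix d ℓ hd hL b₀ b₁ Mstar N c₀ hc₀ := (specMix d ℓ hd hL b₀ b₁ Mstar N c₀ hc₀).2.2.2.1

/-- ★★★ **THE ROWS-18 MIXED `L²` LEG (the `L2MixedLegs37.lm` BODY) AT THE NAMED CONSTANTS** — dag-n06-w7's `blockBd_mixedLeg_memberY` with its existential constants replaced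
by the closed terms `MMix aMix BMix δMix`: for every member `x` with `MMix ≤ M_x`, every `α₀ > 0` with `c₀·M_x·α₀ ≤ aMix`, every configuration `U` of the (3.35) class, every
faithful `bI`, every `R₀ H₀`, every walk-letter record `𝔬 𝔡` (any index type, one index `ic` pinned to the cube `c`) satisfying the pins:
`BlockBd (toB6 (geo9Y x) R₀ H₀) 𝔬.blk 𝔬.blk (𝔡.Dd U ν ∘ₗ ((mulOp (𝔬.h ic) * 𝔬.Gsq U ic * mulOp (𝔬.h ic)) ∘ₗ 𝔡.Dsd U μ)) (1_{SblkY x bI c}(a)·BMix·e^{−δMix·d(a,a′)})`.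
[cite: Balaban1985BackgroundPropagators, Cor 3.6 p.408, Thm 3.1 (3.46) p.398, (3.87)–(3.90) pp.409–410, (3.35) p.396; Balaban1984PropagatorsII, (2.46) p.231, (2.51)–(2.54) pp.232–233, p.235] -/
theorem blockBd_mixedLeg_memberY_at {G : Subgroup (Matrix (Fin N) (Fin N) ℂ)ˣ} (hG : G ≤ B7Prop2Explicit.unitaryUnits (Matrix (Fin N) (Fin N) ℂ))
    (x : MemberY d ℓ hd hL b₀ b₁ Mstar) (hM : MMix d ℓ hd hL b₀ b₁ Mstar N c₀ hc₀ ≤ (geo9Y x).M) (α₀ : ℝ) (hα₀ : 0 < α₀)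
    (ha : c₀ * (geo9Y x).M * α₀ ≤ aMix d ℓ hd hL b₀ b₁ Mstar N c₀ hc₀)
    (U : (bg9Y (Matrix (Fin N) (Fin N) ℂ) G x).Cfg) (hU : (bg9Y (Matrix (Fin N) (Fin N) ℂ) G x).Reg335 c₀ α₀ U)
    {bI : FBondY x.toKIdx → IBondY x.toKIdx} (hlev : ∀ f, lvl x.hN x.D x.hk (bI f) = (blkV1 x.hN x.D f).1.1)
    (hβ1 : ∀ f, (geomT x.D).dist (β x.hN x.D x.hk (bI f)) (blkV1 x.hN x.D f) ≤ 1) (R₀ : ℝ) (H₀ : Prop) [Fintype (geo9Y x).Site]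
    {Y ι : Type} (𝔬 : Ops (geo9Y x) (bg9Y (Matrix (Fin N) (Fin N) ℂ) G x) (XSK (TrIdx N) x.toKIdx) Y ι) (𝔡 : DirOps37 𝔬 (Fin (d + 1)))
    (c : ↥(cubes x.toKIdx.D.toDomains)) (ic : ι) (ν μ : Fin (d + 1))
    (hblk : 𝔬.blk = blkSK x.toKIdx (sIK x.toKIdx bI)) (hh : 𝔬.h ic = hWalkY x c)
    (hGsq : 𝔬.Gsq U ic = gsqcoS x (trBasis N) (bg9Y (Matrix (Fin N) (Fin N) ℂ) G x) (fun U => U) (parSymY x.toKIdx) c U)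
    (hDd : 𝔡.Dd U ν = (etaS x.toKIdx)⁻¹ • coordOpK (trBasis N) (fun _ : Fin (d + 1) => (cdSL x.toKIdx U ν).restrictScalars ℝ))
    (hDsd : 𝔡.Dsd U μ = (etaS x.toKIdx)⁻¹ • coordOpK (trBasis N) (fun _ : Fin (d + 1) => (cdsSL x.toKIdx U μ).restrictScalars ℝ)) :
    BlockBd (g := toB6 (geo9Y x) R₀ H₀) 𝔬.blk 𝔬.blk (𝔡.Dd U ν ∘ₗ ((mulOp (𝔬.h ic) * 𝔬.Gsq U ic * mulOp (𝔬.h ic)) ∘ₗ 𝔡.Dsd U μ))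
      (fun a a' => (if a ∈ SblkY x bI c then (1 : ℝ) else 0) * (BMix d ℓ hd hL b₀ b₁ Mstar N c₀ hc₀ * Real.exp (-(δMix d ℓ hd hL b₀ b₁ Mstar N c₀ hc₀ * (geo9Y x).dist a a')))) :=
  (specMix d ℓ hd hL b₀ b₁ Mstar N c₀ hc₀).2.2.2.2 hG x hM α₀ hα₀ ha U hU hlev hβ1 R₀ H₀ 𝔬 𝔡 c ic ν μ hblk hh hGsq hDd hDsd

/-- ★★★ **THE SCHEMA `L2MixedLegs37` AT THE NAMED CONSTANTS** (`ι := cubes`, every cube pinned; the indicator decided by the certificate's own `DecidableEq (geo9Y x).Site`):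
`L2MixedLegs37 𝔬 𝔡 R₀ H₀ (SblkY x bI) BMix δMix U` — the type of the N06 certificate's rows-18 conjunct at `SM x := SblkY x (bI x)`, constants `BMix`, rate `δMix`.
[cite: Balaban1985BackgroundPropagators, Cor 3.6 p.408, Thm 3.1 (3.46) p.398, (3.87)–(3.90) pp.409–410, (3.35) p.396; Balaban1984PropagatorsII, (2.46) p.231, (2.51)–(2.54) pp.232–233, p.235] -/
theorem l2MixedLegs37_memberY_at {G : Subgroup (Matrix (Fin N) (Fin N) ℂ)ˣ} (hG : G ≤ B7Prop2Explicit.unitaryUnits (Matrix (Fin N) (Fin N) ℂ))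
    (x : MemberY d ℓ hd hL b₀ b₁ Mstar) (hM : MMix d ℓ hd hL b₀ b₁ Mstar N c₀ hc₀ ≤ (geo9Y x).M) (α₀ : ℝ) (hα₀ : 0 < α₀)
    (ha : c₀ * (geo9Y x).M * α₀ ≤ aMix d ℓ hd hL b₀ b₁ Mstar N c₀ hc₀)
    (U : (bg9Y (Matrix (Fin N) (Fin N) ℂ) G x).Cfg) (hU : (bg9Y (Matrix (Fin N) (Fin N) ℂ) G x).Reg335 c₀ α₀ U)
    {bI : FBondY x.toKIdx → IBondY x.toKIdx} (hlev : ∀ f, lvl x.hN x.D x.hk (bI f) = (blkV1 x.hN x.D f).1.1)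
    (hβ1 : ∀ f, (geomT x.D).dist (β x.hN x.D x.hk (bI f)) (blkV1 x.hN x.D f) ≤ 1) (R₀ : ℝ) (H₀ : Prop) [Fintype (geo9Y x).Site] [DecidableEq (geo9Y x).Site]
    {Y : Type} (𝔬 : Ops (geo9Y x) (bg9Y (Matrix (Fin N) (Fin N) ℂ) G x) (XSK (TrIdx N) x.toKIdx) Y ↥(cubes x.toKIdx.D.toDomains)) (𝔡 : DirOps37 𝔬 (Fin (d + 1)))
    (hblk : 𝔬.blk = blkSK x.toKIdx (sIK x.toKIdx bI)) (hh : ∀ c, 𝔬.h c = hWalkY x c)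
    (hGsq : ∀ c, 𝔬.Gsq U c = gsqcoS x (trBasis N) (bg9Y (Matrix (Fin N) (Fin N) ℂ) G x) (fun U => U) (parSymY x.toKIdx) c U)
    (hDd : ∀ ν, 𝔡.Dd U ν = (etaS x.toKIdx)⁻¹ • coordOpK (trBasis N) (fun _ : Fin (d + 1) => (cdSL x.toKIdx U ν).restrictScalars ℝ))
    (hDsd : ∀ μ, 𝔡.Dsd U μ = (etaS x.toKIdx)⁻¹ • coordOpK (trBasis N) (fun _ : Fin (d + 1) => (cdsSL x.toKIdx U μ).restrictScalars ℝ)) :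
    L2MixedLegs37 𝔬 𝔡 R₀ H₀ (SblkY x bI) (BMix d ℓ hd hL b₀ b₁ Mstar N c₀ hc₀) (δMix d ℓ hd hL b₀ b₁ Mstar N c₀ hc₀) U :=
  ⟨fun c ν μ => by
    convert blockBd_mixedLeg_memberY_at d ℓ hd hL b₀ b₁ Mstar N c₀ hc₀ hG x hM α₀ hα₀ ha U hU hlev hβ1 R₀ H₀ 𝔬 𝔡 c c ν μ hblk (hh c) (hGsq c) (hDd ν) (hDsd μ) using 5
    exact Iff.rfl⟩

end Literature.MathematicalPhysics.QuantumFieldTheory.Balaban1983to89.B9Eq346MixedLegAtPinsL2Closed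

end
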